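import Summits.QuantumFields.YangMills.Theorems.BalabanUVNodesN08HaarCompatibilityGuardHybridPartition
import Summits.QuantumFields.YangMills.Theorems.BalabanUVNodesN08CoarseGrainingFarFresh

/-!
# BalabanUVNodes ∕ N08 — FAR COARSE VARIABLES ARE FRESH UNDER THE HYBRID AVERAGING `Ū^S`: the transported (guarded) density is LOCAL — conditionally on
# everything near, the coarse variables of the lines with one free bond outside the end blocks of `S` are PRODUCT HAAR, independent of the density and of the
# near coordinates — the locality half of (G1)

WIDTH SEAT `pub-ymgap-dag-n08-w3` g7, item-3 lineage PART 35 (successor of part 34 `…GuardHybridPartition`; consumes n08-w1 g6's ABSTRACT-Φ freshness `…N08CoarseGrainingFarFresh`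
(p642608: `integral_mul_far_eq_of_coarseGraining`, `integral_mul_comp_eq_farAvg_of_coarseGraining`) at `Φ = Ū^S`, pub-balaban3d's `Proofs.FibreSplit` and the tree's `Spine.NE7.line_inj` BY IMPORT),
2026-08-28.  Track A, DAG node N08 = [Balaban1985UV3] Thm 1 p. 257 (compact) + Thm 2 p. 272; key item K1⁷ `StabilityBAtRecordR13SepCoPH`
(stmt-QuantumFields-20542), `--supports … --as helper`.  COUNT-NEUTRAL.

THE POINT (located; n08-w1 g6's `N08-NO-STACKING-MECHANISM.md` §3 (G1): «LOCALITY of the transported guarded part — NOT typed; obstacle: the guard events of the bonds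
near a far line see that line's bonds»).  The obstacle is real for print's own averaging `Ū`: the event `¬Small U c′` of a far bond `c′` reads the central line of `c′`.  It is
MET by the hybrid averaging `Ū^S` of part 34 (typed (0.4) on `S`, axial off `S`; print's `Ū` on «no guard outside `S`», and the carrier of the positive polymer bound
`μ∘Ū⁻¹ ≤ Σ_S (μ↾G_S)∘(Ū^S)⁻¹`): let `Far` be any set of coarse bonds with one selected bond `line c′ (τ c′)` per far line lying OUTSIDE THE END BLOCKS OF `S`
(`blockOf (line c′ (τ c′)).src ∉ {c.src, c.tgt : c ∈ S}`; then `Far ∩ S = ∅` automatically, §1), and let the integrable density `ρ` not depend on the far-selected bonds (it may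
depend on EVERYTHING else — e.g. `ρ = 1_{G_S}·f` with `f` local near `S`: the guard events of `S` read only the end blocks of `S`).  Then:
* §1 `not_mem_of_far`, ★ `hybrid_congr_of_not_far` (the non-far hybrid coordinates do not read the far-selected bonds: `c ∈ S` by `avgFun_local`, `c ∉ S ∪ Far` by `line_inj` —
  n08-w1's hypothesis `hΦnear` for `Φ = Ū^S`), `hybrid_apply_eq_axialAvg_of_far` (`hΦfar`), `localOff_mul_comp_hybrid`.
* §2 ★★★ `integral_mul_hybrid_far_eq` — **`∫ ρ·g(Ū^S U)·f₂(Ū^S U) dU = (∫ ρ·g(Ū^S U) dU)·(∫ f₂ dV)`** for `g` local off `Far`, `f₂` local on `Far`, and ★★ `integral_mul_comp_hybrid_eq_farAvg`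
  — **`∫ ρ·f(Ū^S U) dU = ∫ ρ·(A_Far f)(Ū^S U) dU`** for every bounded measurable `f` (`(A_Far f)(V) = ∫ f(join(V↾Farᶜ, v)) dHaar^{Far}(v)` inline): ONE-LINE INSTANCES of n08-w1's
  abstract-Φ theorems at `Φ = Ū^S` — under `(ρ·dU)∘(Ū^S)⁻¹` the far coarse variables are product Haar, independent of the near ones; the transported density is a function of the NEAR
  coarse variables: **`B_S` IS LOCAL**.
* §3 ★★ `map_withDensity_hybrid_split_eq_prod` — MEASURE FORM, the shape a density ∕ `rnDeriv` statement reads: for `ρ ≥ 0` integrable, **`(ρ·dU)∘(split_Far ∘ Ū^S)⁻¹ =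
  [near marginal] ⊗ Haar^{Far}`** (`Measure.prod_eq` on rectangles + §2 on indicators + `FibreSplit.measurePreserving_split`); `map_snd_split_fieldMeasure` (`dV∘(snd∘split_Far)⁻¹ = Haar^{Far}`).
* §4 the same at the [B10] slot's averaging `avOfPrint N S₀ j` on `SU(N)`, every `N`, standing range.

HONEST FRAMING.  [folklore] measure theory ∕ lattice bookkeeping BY IMPORT; nothing of Bałaban's asserted; no density bound here (part 36), no cluster expansion, no k-uniform `hmass`
((G2)∕(G3) NOT supplied); E6′ NOT decided; N08 NOT discharged; counts unmoved (typed 28∕28 · discharged 5∕27); one finite 𝕋⁴ programme at fixed ε — R4 closes the CONDITIONAL rung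
`BalabanLadder.UV` only; the Yang–Mills mass gap (Clay) is NOT proved by any of this; nothing continuum ∕ ℝ⁴ ∕ OS.  0 `sorry`, 0 `def`, 0 `instance`, standard axioms.
-/

noncomputable section

open MeasureTheory
open scoped ENNReal

namespace Summit.QuantumFields.YangMills.BalabanUVNodes.N08HaarCompatibilityGuardHybridFresh

open Literature.MathematicalPhysics.QuantumFieldTheory.Balaban1983to89
open Literature.MathematicalPhysics.QuantumFieldTheory.Balaban1983to89.AveragingRT
  (axialAvg measurable_axialAvg line lineSite blockOf_lineSite integrable_of_abs_le)
open Literature.MathematicalPhysics.QuantumFieldTheory.Balaban1983to89.BlockAveraging (Small avgFun measurable_avgFun)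
open Summit.QuantumFields.Balaban3D.Proofs
open Summit.QuantumFields.BalabanUV.T4Continuum.Spine.NE7 (line_inj)
open Summit.QuantumFields.YangMills.BalabanUVNodes.N08CoarseGrainingFarFresh (integral_mul_far_eq_of_coarseGraining integral_mul_comp_eq_farAvg_of_coarseGraining)
open Summit.QuantumFields.YangMills.BalabanUVNodes.N08HaarCompatibilityGuardHybridPartition
  (hybrid_apply_eq_of_mem hybrid_apply_eq_of_not_mem measurable_hybrid)

/-! ## §1 Geometry: the far-selected bonds are not read by the non-far hybrid coordinates -/

section Geometry

variable {P : Params} {j : ℕ} {G : Type*} [GaugeGroup G] (ℰ : LoopAverage G) [DecidableEq (PBond P (j + 1))]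

omit [DecidableEq (PBond P (j + 1))] in
/-- A far bond (selected bond outside the end blocks of `S`) is not in `S`: its selected bond issues from one of its own end blocks (`blockOf_lineSite`). [folklore] -/
theorem not_mem_of_far (hj : j + 1 ≤ P.m + P.K) (S : Finset (PBond P (j + 1))) (Far : PBond P (j + 1) → Prop) (τ : PBond P (j + 1) → ℕ)
    (hτ : ∀ c, Far c → τ c < P.L)
    (hτS : ∀ c', Far c' → ∀ c ∈ S, blockOf (lineSite c' (τ c')) ≠ c.src ∧ blockOf (lineSite c' (τ c')) ≠ c.tgt)
    {c : PBond P (j + 1)} (hc : Far c) : c ∉ S := by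
  intro hcS
  rcases blockOf_lineSite hj c (hτ c hc) with h | h
  · exact (hτS c hc c hcS).1 h
  · exact (hτS c hc c hcS).2 h

/-- ★ **THE NON-FAR HYBRID COORDINATES DO NOT READ THE FAR-SELECTED BONDS**: if `W`, `W′` agree off `{line c′ (τ c′) : c′ ∈ Far}`, then `Ū^S W c = Ū^S W′ c` for every `c ∉ Far`
(`c ∈ S`: `Ū(c)` reads only the end blocks of `c`, which contain no far-selected bond; `c ∉ S`: `axial(c)` reads only its own line, whose bonds are selected only if `c ∈ Far` —
`line_inj`).  Standing range. [cite: Balaban1985Averaging, p.19 (locality); Balaban1984PropagatorsI, (1.7) p.18 (bookkeeping)] -/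
theorem hybrid_congr_of_not_far (hj : j + 1 ≤ P.m + P.K) (S : Finset (PBond P (j + 1))) (Far : PBond P (j + 1) → Prop) (τ : PBond P (j + 1) → ℕ)
    (hτ : ∀ c, Far c → τ c < P.L)
    (hτS : ∀ c', Far c' → ∀ c ∈ S, blockOf (lineSite c' (τ c')) ≠ c.src ∧ blockOf (lineSite c' (τ c')) ≠ c.tgt)
    {W W' : GaugeField P j G} (hWW' : ∀ b, (¬ ∃ c, Far c ∧ line c (τ c) = b) → W b = W' b) {c : PBond P (j + 1)} (hc : ¬ Far c) :
    (if c ∈ S then avgFun ℰ W c else axialAvg W c) = (if c ∈ S then avgFun ℰ W' c else axialAvg W' c) := by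
  by_cases hcS : c ∈ S
  · refine hybrid_apply_eq_of_mem ℰ hj S hcS fun b hb => hWW' b ?_
    rintro ⟨c', hc', rfl⟩
    rcases hb with h | h
    · exact (hτS c' hc' c hcS).1 h
    · exact (hτS c' hc' c hcS).2 h
  · refine hybrid_apply_eq_of_not_mem ℰ S hcS fun s hs => hWW' _ ?_
    rintro ⟨c', hc', h⟩
    obtain ⟨h1, -⟩ := line_inj hj (hτ c' hc') hs h
    exact hc (h1 ▸ hc')

/-- On the far bonds the hybrid coordinate is the axial one (`Far ∩ S = ∅`). [folklore] -/
theorem hybrid_apply_eq_axialAvg_of_far (hj : j + 1 ≤ P.m + P.K) (S : Finset (PBond P (j + 1))) (Far : PBond P (j + 1) → Prop) (τ : PBond P (j + 1) → ℕ)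
    (hτ : ∀ c, Far c → τ c < P.L)
    (hτS : ∀ c', Far c' → ∀ c ∈ S, blockOf (lineSite c' (τ c')) ≠ c.src ∧ blockOf (lineSite c' (τ c')) ≠ c.tgt)
    (W : GaugeField P j G) {c : PBond P (j + 1)} (hc : Far c) :
    (if c ∈ S then avgFun ℰ W c else axialAvg W c) = axialAvg W c := by
  rw [if_neg (not_mem_of_far hj S Far τ hτ hτS hc)]

/-- **A density local off the far-selected bonds times a near-local coarse observable of `Ū^S` is again local off the far-selected bonds.** [folklore] -/
theorem localOff_mul_comp_hybrid (hj : j + 1 ≤ P.m + P.K) (S : Finset (PBond P (j + 1))) (Far : PBond P (j + 1) → Prop) (τ : PBond P (j + 1) → ℕ)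
    (hτ : ∀ c, Far c → τ c < P.L)
    (hτS : ∀ c', Far c' → ∀ c ∈ S, blockOf (lineSite c' (τ c')) ≠ c.src ∧ blockOf (lineSite c' (τ c')) ≠ c.tgt)
    (ρ : Density P j G) (hloc : ∀ W W' : GaugeField P j G, (∀ b, (¬ ∃ c, Far c ∧ line c (τ c) = b) → W b = W' b) → ρ W = ρ W')
    (g : GaugeField P (j + 1) G → ℝ) (hlocg : ∀ V V' : GaugeField P (j + 1) G, (∀ c, ¬ Far c → V c = V' c) → g V = g V')
    (W W' : GaugeField P j G) (hWW' : ∀ b, (¬ ∃ c, Far c ∧ line c (τ c) = b) → W b = W' b) :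
    ρ W * g (fun c => if c ∈ S then avgFun ℰ W c else axialAvg W c) = ρ W' * g (fun c => if c ∈ S then avgFun ℰ W' c else axialAvg W' c) := by
  rw [hloc W W' hWW', hlocg _ _ fun c hc => hybrid_congr_of_not_far ℰ hj S Far τ hτ hτS hWW' hc]

end Geometry

/-! ## §2 Fresh far variables under the hybrid averaging: the independence identity -/

section Fresh

variable {P : Params} {j : ℕ} {G : Type} [GaugeGroup G] (ℰ : LoopAverage G) [DecidableEq (PBond P (j + 1))] [MeasurableSpace G] [RegularGaugeGroup G] [HaarData G]

/-- ★★★ **FAR COARSE VARIABLES ARE FRESH HAAR UNDER THE HYBRID AVERAGING, INDEPENDENT OF EVERYTHING ELSE.**  Let `S` be a finset of coarse bonds, `Far` a set of coarse bonds with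
a selection `τ` of one bond per far line lying outside the end blocks of `S`, and `ρ` an integrable density not depending on the far-selected bonds.  Then for every bounded
measurable `g` local OFF `Far` and `f₂` local ON `Far`:  **`∫ ρ(U)·g(Ū^S U)·f₂(Ū^S U) dU = (∫ ρ(U)·g(Ū^S U) dU)·(∫ f₂ dV)`** — along the hybrid averaging the far coarse
variables are distributed as product Haar, independently of the density and of the near coarse variables (the guarded ones included).  One-line instance of n08-w1's
`integral_mul_far_eq_of_coarseGraining` at `Φ = Ū^S` (`hΦfar`, `hΦnear` = §1).
[cite: Balaban1985UV3, (10) p.258 + (48)–(49) p.268 (bookkeeping); Balaban1985Averaging, (15) p.19; Balaban1987RG1, (0.4) p.253] -/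
theorem integral_mul_hybrid_far_eq (hj : j + 1 ≤ P.m + P.K) (hE : ∀ n, Measurable fun W : Fin (n + 1) → G => ℰ.E W) (S : Finset (PBond P (j + 1)))
    (Far : PBond P (j + 1) → Prop) [DecidablePred Far] (τ : PBond P (j + 1) → ℕ) (hτ : ∀ c, Far c → τ c < P.L)
    (hτS : ∀ c', Far c' → ∀ c ∈ S, blockOf (lineSite c' (τ c')) ≠ c.src ∧ blockOf (lineSite c' (τ c')) ≠ c.tgt)
    [DecidablePred fun b : PBond P j => ∃ c, Far c ∧ line c (τ c) = b]
    (ρ : Density P j G) (hρ : Integrable ρ (fieldMeasure P j G))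
    (hloc : ∀ W W' : GaugeField P j G, (∀ b, (¬ ∃ c, Far c ∧ line c (τ c) = b) → W b = W' b) → ρ W = ρ W')
    (g f₂ : GaugeField P (j + 1) G → ℝ) (hg : Measurable g) (hf₂ : Measurable f₂) (Cg C₂ : ℝ) (hCg : ∀ V, |g V| ≤ Cg) (hC₂ : ∀ V, |f₂ V| ≤ C₂)
    (hlocg : ∀ V V' : GaugeField P (j + 1) G, (∀ c, ¬ Far c → V c = V' c) → g V = g V')
    (hloc₂ : ∀ V V' : GaugeField P (j + 1) G, (∀ c, Far c → V c = V' c) → f₂ V = f₂ V') :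
    ∫ U, ρ U * (g (fun c => if c ∈ S then avgFun ℰ U c else axialAvg U c) * f₂ (fun c => if c ∈ S then avgFun ℰ U c else axialAvg U c))
        ∂(fieldMeasure P j G) =
      (∫ U, ρ U * g (fun c => if c ∈ S then avgFun ℰ U c else axialAvg U c) ∂(fieldMeasure P j G)) * ∫ V, f₂ V ∂(fieldMeasure P (j + 1) G) := by
  exact integral_mul_far_eq_of_coarseGraining hj Far τ hτ _ (measurable_hybrid ℰ hE S)
    (fun U _ hc => hybrid_apply_eq_axialAvg_of_far ℰ hj S Far τ hτ hτS U hc)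
    (fun _ _ hUU' _ hc => hybrid_congr_of_not_far ℰ hj S Far τ hτ hτS hUU' hc) ρ hρ hloc g f₂ hg hf₂ Cg C₂ hCg hC₂ hlocg hloc₂

/-- ★★ **THE FAR COARSE VARIABLES UNDER `(ρ·dU)∘(Ū^S)⁻¹` ARE HAAR** (the case `g ≡ 1`): `∫ ρ·f₂(Ū^S U) dU = (∫ ρ dU)·(∫ f₂ dV)` for `f₂` local on `Far`.
[cite: Balaban1985UV3, (10) p.258 (bookkeeping); Balaban1985Averaging, (15) p.19] -/
theorem integral_mul_far_comp_hybrid_eq (hj : j + 1 ≤ P.m + P.K) (hE : ∀ n, Measurable fun W : Fin (n + 1) → G => ℰ.E W) (S : Finset (PBond P (j + 1)))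
    (Far : PBond P (j + 1) → Prop) [DecidablePred Far] (τ : PBond P (j + 1) → ℕ) (hτ : ∀ c, Far c → τ c < P.L)
    (hτS : ∀ c', Far c' → ∀ c ∈ S, blockOf (lineSite c' (τ c')) ≠ c.src ∧ blockOf (lineSite c' (τ c')) ≠ c.tgt)
    [DecidablePred fun b : PBond P j => ∃ c, Far c ∧ line c (τ c) = b]
    (ρ : Density P j G) (hρ : Integrable ρ (fieldMeasure P j G))
    (hloc : ∀ W W' : GaugeField P j G, (∀ b, (¬ ∃ c, Far c ∧ line c (τ c) = b) → W b = W' b) → ρ W = ρ W')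
    (f₂ : GaugeField P (j + 1) G → ℝ) (hf₂ : Measurable f₂) (C₂ : ℝ) (hC₂ : ∀ V, |f₂ V| ≤ C₂)
    (hloc₂ : ∀ V V' : GaugeField P (j + 1) G, (∀ c, Far c → V c = V' c) → f₂ V = f₂ V') :
    ∫ U, ρ U * f₂ (fun c => if c ∈ S then avgFun ℰ U c else axialAvg U c) ∂(fieldMeasure P j G) =
      (∫ U, ρ U ∂(fieldMeasure P j G)) * ∫ V, f₂ V ∂(fieldMeasure P (j + 1) G) := by
  have h := integral_mul_hybrid_far_eq ℰ hj hE S Far τ hτ hτS ρ hρ hloc (fun _ => (1 : ℝ)) f₂ measurable_const hf₂ 1 C₂ (fun _ => by simp) hC₂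
    (fun _ _ _ => rfl) hloc₂
  simpa only [one_mul, mul_one] using h

/-- ★★ **THE FAR-AVERAGE IDENTITY ALONG THE HYBRID AVERAGING**: with `S`, `Far`, `τ`, `ρ` as above, for every bounded measurable `f` on the coarse fields
`∫ ρ(U)·f(Ū^S U) dU = ∫ ρ(U)·(A f)(Ū^S U) dU`, `(A f)(V) := ∫ f(join(V↾Farᶜ, v)) dHaar^{Far}(v)` (written inline) — CONDITIONALLY ON EVERYTHING NEAR THE FAR COARSE VARIABLES ARE PRODUCT HAAR;
in `IsRT` currency the transported density of `ρ` along `Ū^S` is a function of the NEAR coarse variables: the transported guarded part is LOCAL.  One-line instance of n08-w1's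
`integral_mul_comp_eq_farAvg_of_coarseGraining` at `Φ = Ū^S`. [cite: Balaban1985UV3, (10) p.258 + (48)–(49) p.268 (bookkeeping); Balaban1985Averaging, (15) p.19; Balaban1987RG1, (0.4) p.253] -/
theorem integral_mul_comp_hybrid_eq_farAvg (hj : j + 1 ≤ P.m + P.K) (hE : ∀ n, Measurable fun W : Fin (n + 1) → G => ℰ.E W) (S : Finset (PBond P (j + 1)))
    (Far : PBond P (j + 1) → Prop) [DecidablePred Far] (τ : PBond P (j + 1) → ℕ) (hτ : ∀ c, Far c → τ c < P.L)
    (hτS : ∀ c', Far c' → ∀ c ∈ S, blockOf (lineSite c' (τ c')) ≠ c.src ∧ blockOf (lineSite c' (τ c')) ≠ c.tgt)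
    [DecidablePred fun b : PBond P j => ∃ c, Far c ∧ line c (τ c) = b]
    (ρ : Density P j G) (hρ : Integrable ρ (fieldMeasure P j G))
    (hloc : ∀ W W' : GaugeField P j G, (∀ b, (¬ ∃ c, Far c ∧ line c (τ c) = b) → W b = W' b) → ρ W = ρ W')
    (f : GaugeField P (j + 1) G → ℝ) (hf : Measurable f) (C : ℝ) (hC : ∀ V, |f V| ≤ C) :
    ∫ U, ρ U * f (fun c => if c ∈ S then avgFun ℰ U c else axialAvg U c) ∂(fieldMeasure P j G) =
      ∫ U, ρ U * (∫ v, f ((FibreSplit.splitEquiv Far (P := P) (G := G)).symm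
          ((FibreSplit.splitEquiv Far (P := P) (G := G) (fun c => if c ∈ S then avgFun ℰ U c else axialAvg U c)).1, v))
        ∂(Measure.pi fun _ : {c : PBond P (j + 1) // ¬¬ Far c} => (HaarData.haar : Measure G))) ∂(fieldMeasure P j G) :=
  integral_mul_comp_eq_farAvg_of_coarseGraining hj Far τ hτ _ (measurable_hybrid ℰ hE S)
    (fun U _ hc => hybrid_apply_eq_axialAvg_of_far ℰ hj S Far τ hτ hτS U hc)
    (fun _ _ hUU' _ hc => hybrid_congr_of_not_far ℰ hj S Far τ hτ hτS hUU' hc) ρ hρ hloc f hf C hC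

end Fresh

/-! ## §3 Measure form: the image of `ρ·dU` under `split_Far ∘ Ū^S` is (near marginal) ⊗ Haar^{Far} -/

section Product

variable {P : Params} {j : ℕ} {G : Type} [GaugeGroup G] (ℰ : LoopAverage G) [DecidableEq (PBond P (j + 1))] [MeasurableSpace G] [RegularGaugeGroup G] [HaarData G]

omit [GaugeGroup G] [RegularGaugeGroup G] [HaarData G] [DecidableEq (PBond P (j + 1))] in
/-- The near component of the coarse splitting reads only the non-far coordinates (definitional). [folklore] -/
theorem splitEquiv_fst_apply (Far : PBond P (j + 1) → Prop) [DecidablePred Far] (V : GaugeField P (j + 1) G) (c : {c : PBond P (j + 1) // ¬ Far c}) :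
    (FibreSplit.splitEquiv Far (P := P) (G := G) V).1 c = V c.1 := rfl

omit [GaugeGroup G] [RegularGaugeGroup G] [HaarData G] [DecidableEq (PBond P (j + 1))] in
/-- The far component of the coarse splitting reads only the far coordinates (definitional). [folklore] -/
theorem splitEquiv_snd_apply (Far : PBond P (j + 1) → Prop) [DecidablePred Far] (V : GaugeField P (j + 1) G) (c : {c : PBond P (j + 1) // ¬¬ Far c}) :
    (FibreSplit.splitEquiv Far (P := P) (G := G) V).2 c = V c.1 := rfl

omit [RegularGaugeGroup G] [DecidableEq (PBond P (j + 1))] in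
/-- **THE FAR MARGINAL OF `dV` IS `Haar^{Far}`**: `dV ∘ (snd ∘ split_Far)⁻¹ = Haar^{Far}` (`FibreSplit.measurePreserving_split` + `Measure.map_snd_prod`). [folklore] -/
theorem map_snd_split_fieldMeasure (Far : PBond P (j + 1) → Prop) [DecidablePred Far] :
    (fieldMeasure P (j + 1) G).map (fun V => (FibreSplit.splitEquiv Far (P := P) (G := G) V).2) =
      Measure.pi fun _ : {c : PBond P (j + 1) // ¬¬ Far c} => (HaarData.haar : Measure G) := by
  haveI := HaarData.isProb (G := G)
  have hmp := FibreSplit.measurePreserving_split Far (P := P) (j := j + 1) (G := G)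
  rw [show (fun V => (FibreSplit.splitEquiv Far (P := P) (G := G) V).2) = Prod.snd ∘ (FibreSplit.splitEquiv Far (P := P) (G := G)) from rfl,
    ← Measure.map_map measurable_snd (FibreSplit.splitEquiv Far (P := P) (G := G)).measurable, hmp.map_eq, Measure.map_snd_prod, measure_univ, one_smul]

/-- ★★ **MEASURE FORM OF FRESHNESS: `(ρ·dU)∘(split_Far ∘ Ū^S)⁻¹ = [near marginal] ⊗ Haar^{Far}`** for `ρ ≥ 0` measurable and integrable, local off the far-selected bonds
(`Measure.prod_eq` on measurable rectangles, §2 on their indicators). [cite: Balaban1985UV3, (10) p.258 + (48)–(49) p.268 (bookkeeping); Balaban1985Averaging, (15) p.19] -/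
theorem map_withDensity_hybrid_split_eq_prod (hj : j + 1 ≤ P.m + P.K) (hE : ∀ n, Measurable fun W : Fin (n + 1) → G => ℰ.E W) (S : Finset (PBond P (j + 1)))
    (Far : PBond P (j + 1) → Prop) [DecidablePred Far] (τ : PBond P (j + 1) → ℕ) (hτ : ∀ c, Far c → τ c < P.L)
    (hτS : ∀ c', Far c' → ∀ c ∈ S, blockOf (lineSite c' (τ c')) ≠ c.src ∧ blockOf (lineSite c' (τ c')) ≠ c.tgt)
    [DecidablePred fun b : PBond P j => ∃ c, Far c ∧ line c (τ c) = b]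
    (ρ : Density P j G) (hρ0 : ∀ W, 0 ≤ ρ W) (hρ : Integrable ρ (fieldMeasure P j G))
    (hloc : ∀ W W' : GaugeField P j G, (∀ b, (¬ ∃ c, Far c ∧ line c (τ c) = b) → W b = W' b) → ρ W = ρ W') :
    ((fieldMeasure P j G).withDensity fun U => ENNReal.ofReal (ρ U)).map
        (fun U => FibreSplit.splitEquiv Far (P := P) (G := G) (fun c => if c ∈ S then avgFun ℰ U c else axialAvg U c)) =
      (((fieldMeasure P j G).withDensity fun U => ENNReal.ofReal (ρ U)).map
          (fun U => (FibreSplit.splitEquiv Far (P := P) (G := G) (fun c => if c ∈ S then avgFun ℰ U c else axialAvg U c)).1)).prod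
        (Measure.pi fun _ : {c : PBond P (j + 1) // ¬¬ Far c} => (HaarData.haar : Measure G)) := by
  haveI := HaarData.isProb (G := G)
  have hHm : Measurable fun U : GaugeField P j G => (fun c => if c ∈ S then avgFun ℰ U c else axialAvg U c : GaugeField P (j + 1) G) :=
    measurable_hybrid ℰ hE S
  have hΦm : Measurable fun U : GaugeField P j G => FibreSplit.splitEquiv Far (P := P) (G := G) (fun c => if c ∈ S then avgFun ℰ U c else axialAvg U c) :=
    (FibreSplit.splitEquiv Far (P := P) (G := G)).measurable.comp hHm
  have hΦ1m : Measurable fun U : GaugeField P j G => (FibreSplit.splitEquiv Far (P := P) (G := G) (fun c => if c ∈ S then avgFun ℰ U c else axialAvg U c)).1 :=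
    measurable_fst.comp hΦm
  set μρ : Measure (GaugeField P j G) := (fieldMeasure P j G).withDensity fun U => ENNReal.ofReal (ρ U) with hμρ
  haveI hfin : IsFiniteMeasure μρ := by
    refine ⟨?_⟩
    rw [hμρ, withDensity_apply _ MeasurableSet.univ, Measure.restrict_univ]
    exact (lintegral_ofReal_le_lintegral_enorm ρ).trans_lt hρ.2
  haveI : IsFiniteMeasure (μρ.map fun U : GaugeField P j G =>
      (FibreSplit.splitEquiv Far (P := P) (G := G) (fun c => if c ∈ S then avgFun ℰ U c else axialAvg U c)).1) :=
    Measure.isFiniteMeasure_map _ _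
  -- the integral of `ρ` against an indicator is the `μρ`-measure
  have hμρ_apply : ∀ {A : Set (GaugeField P j G)}, MeasurableSet A →
      μρ A = ENNReal.ofReal (∫ U, ρ U * A.indicator (fun _ => (1 : ℝ)) U ∂(fieldMeasure P j G)) := by
    intro A hA
    rw [hμρ, withDensity_apply _ hA]
    have hint : Integrable (fun U => ρ U * A.indicator (fun _ => (1 : ℝ)) U) (fieldMeasure P j G) :=
      hρ.mul_bdd ((measurable_const.indicator hA).aestronglyMeasurable) (c := 1)
        (Filter.Eventually.of_forall fun U => by by_cases hU : U ∈ A <;> simp [Set.indicator, hU])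
    rw [ofReal_integral_eq_lintegral_ofReal hint (Filter.Eventually.of_forall fun U => mul_nonneg (hρ0 U)
      (by by_cases hU : U ∈ A <;> simp [Set.indicator, hU])), ← lintegral_indicator hA]
    refine lintegral_congr fun U => ?_
    by_cases hU : U ∈ A
    · simp [Set.indicator, hU]
    · simp [Set.indicator, hU]
  symm
  refine Measure.prod_eq fun s t hs ht => ?_
  have hpre : MeasurableSet ((fun U : GaugeField P j G =>
      FibreSplit.splitEquiv Far (P := P) (G := G) (fun c => if c ∈ S then avgFun ℰ U c else axialAvg U c)) ⁻¹' (s ×ˢ t)) := hΦm (hs.prod ht)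
  have hpre1 : MeasurableSet ((fun U : GaugeField P j G =>
      (FibreSplit.splitEquiv Far (P := P) (G := G) (fun c => if c ∈ S then avgFun ℰ U c else axialAvg U c)).1) ⁻¹' s) := hΦ1m hs
  rw [Measure.map_apply hΦm (hs.prod ht), Measure.map_apply hΦ1m hs, hμρ_apply hpre, hμρ_apply hpre1]
  -- the indicator of the rectangle splits as a near factor times a far factor
  have hgm : Measurable fun V : GaugeField P (j + 1) G => s.indicator (fun _ => (1 : ℝ)) (FibreSplit.splitEquiv Far (P := P) (G := G) V).1 :=
    (measurable_const.indicator hs).comp (measurable_fst.comp (FibreSplit.splitEquiv Far (P := P) (G := G)).measurable)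
  have hf₂m : Measurable fun V : GaugeField P (j + 1) G => t.indicator (fun _ => (1 : ℝ)) (FibreSplit.splitEquiv Far (P := P) (G := G) V).2 :=
    (measurable_const.indicator ht).comp (measurable_snd.comp (FibreSplit.splitEquiv Far (P := P) (G := G)).measurable)
  have hgb : ∀ V : GaugeField P (j + 1) G, |s.indicator (fun _ => (1 : ℝ)) (FibreSplit.splitEquiv Far (P := P) (G := G) V).1| ≤ 1 := fun V => by
    by_cases h : (FibreSplit.splitEquiv Far (P := P) (G := G) V).1 ∈ s <;> simp [Set.indicator, h]
  have hf₂b : ∀ V : GaugeField P (j + 1) G, |t.indicator (fun _ => (1 : ℝ)) (FibreSplit.splitEquiv Far (P := P) (G := G) V).2| ≤ 1 := fun V => by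
    by_cases h : (FibreSplit.splitEquiv Far (P := P) (G := G) V).2 ∈ t <;> simp [Set.indicator, h]
  have hlocg : ∀ V V' : GaugeField P (j + 1) G, (∀ c, ¬ Far c → V c = V' c) →
      s.indicator (fun _ => (1 : ℝ)) (FibreSplit.splitEquiv Far (P := P) (G := G) V).1 = s.indicator (fun _ => (1 : ℝ)) (FibreSplit.splitEquiv Far (P := P) (G := G) V').1 := by
    intro V V' hVV'
    have : (FibreSplit.splitEquiv Far (P := P) (G := G) V).1 = (FibreSplit.splitEquiv Far (P := P) (G := G) V').1 :=
      funext fun c => by rw [splitEquiv_fst_apply, splitEquiv_fst_apply, hVV' c.1 c.2]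
    rw [this]
  have hloc₂ : ∀ V V' : GaugeField P (j + 1) G, (∀ c, Far c → V c = V' c) →
      t.indicator (fun _ => (1 : ℝ)) (FibreSplit.splitEquiv Far (P := P) (G := G) V).2 = t.indicator (fun _ => (1 : ℝ)) (FibreSplit.splitEquiv Far (P := P) (G := G) V').2 := by
    intro V V' hVV'
    have : (FibreSplit.splitEquiv Far (P := P) (G := G) V).2 = (FibreSplit.splitEquiv Far (P := P) (G := G) V').2 :=
      funext fun c => by rw [splitEquiv_snd_apply, splitEquiv_snd_apply, hVV' c.1 (not_not.1 c.2)]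
    rw [this]
  have hrect : ∀ U : GaugeField P j G,
      ((fun U : GaugeField P j G => FibreSplit.splitEquiv Far (P := P) (G := G) (fun c => if c ∈ S then avgFun ℰ U c else axialAvg U c)) ⁻¹' (s ×ˢ t)).indicator
          (fun _ => (1 : ℝ)) U =
        s.indicator (fun _ => (1 : ℝ)) (FibreSplit.splitEquiv Far (P := P) (G := G) (fun c => if c ∈ S then avgFun ℰ U c else axialAvg U c)).1 *
          t.indicator (fun _ => (1 : ℝ)) (FibreSplit.splitEquiv Far (P := P) (G := G) (fun c => if c ∈ S then avgFun ℰ U c else axialAvg U c)).2 := by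
    intro U
    simp only [Set.indicator, Set.mem_preimage, Set.mem_prod]
    by_cases h1 : (FibreSplit.splitEquiv Far (P := P) (G := G) (fun c => if c ∈ S then avgFun ℰ U c else axialAvg U c)).1 ∈ s <;>
      by_cases h2 : (FibreSplit.splitEquiv Far (P := P) (G := G) (fun c => if c ∈ S then avgFun ℰ U c else axialAvg U c)).2 ∈ t <;> simp [h1, h2]
  have hnear : ∀ U : GaugeField P j G,
      ((fun U : GaugeField P j G => (FibreSplit.splitEquiv Far (P := P) (G := G) (fun c => if c ∈ S then avgFun ℰ U c else axialAvg U c)).1) ⁻¹' s).indicator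
          (fun _ => (1 : ℝ)) U =
        s.indicator (fun _ => (1 : ℝ)) (FibreSplit.splitEquiv Far (P := P) (G := G) (fun c => if c ∈ S then avgFun ℰ U c else axialAvg U c)).1 :=
    fun U => rfl
  simp_rw [hrect, hnear]
  rw [integral_mul_hybrid_far_eq ℰ hj hE S Far τ hτ hτS ρ hρ hloc _ _ hgm hf₂m 1 1 hgb hf₂b hlocg hloc₂]
  -- the far factor is the Haar^{Far} measure of `t`
  have hfar : ∫ V, t.indicator (fun _ => (1 : ℝ)) (FibreSplit.splitEquiv Far (P := P) (G := G) V).2 ∂(fieldMeasure P (j + 1) G) =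
      ((Measure.pi fun _ : {c : PBond P (j + 1) // ¬¬ Far c} => (HaarData.haar : Measure G)) t).toReal := by
    have hm2 : Measurable fun V : GaugeField P (j + 1) G => (FibreSplit.splitEquiv Far (P := P) (G := G) V).2 :=
      measurable_snd.comp (FibreSplit.splitEquiv Far (P := P) (G := G)).measurable
    rw [← map_snd_split_fieldMeasure Far, Measure.map_apply hm2 ht, ← measureReal_def, ← integral_indicator_one (hm2 ht)]
    refine integral_congr_ae (Filter.Eventually.of_forall fun V => ?_)
    by_cases h : (FibreSplit.splitEquiv Far (P := P) (G := G) V).2 ∈ t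
    · simp [Set.indicator, h]
    · simp [Set.indicator, h]
  have hnn : 0 ≤ ∫ U, ρ U * s.indicator (fun _ => (1 : ℝ))
      (FibreSplit.splitEquiv Far (P := P) (G := G) (fun c => if c ∈ S then avgFun ℰ U c else axialAvg U c)).1 ∂(fieldMeasure P j G) :=
    integral_nonneg fun U => mul_nonneg (hρ0 U)
      (by by_cases h : (FibreSplit.splitEquiv Far (P := P) (G := G) (fun c => if c ∈ S then avgFun ℰ U c else axialAvg U c)).1 ∈ s <;> simp [Set.indicator, h])
  rw [hfar, ENNReal.ofReal_mul hnn, ENNReal.ofReal_toReal (measure_ne_top _ _)]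

end Product

/-! ## §4 At the [B10] slot's averaging `avOfPrint N S₀ j` on `SU(N)` -/

section Slot

open Literature.MathematicalPhysics.QuantumFieldTheory.Balaban1985CMP102.Setting (Scales)
open Literature.MathematicalPhysics.QuantumFieldTheory.Balaban1983to89.ExpMeanLog (expMeanLogSU measurable_expMeanLogSU_E)
open Literature.MathematicalPhysics.QuantumFieldTheory.Balaban1983to89.Node00 (SU)

variable (N : ℕ) [NeZero N] {L : ℕ}

/-- ★★★ **AT THE SLOT: FAR COARSE VARIABLES ARE FRESH UNDER THE HYBRID OF PRINT'S AVERAGING** (printed exp-mean-log on `S`, axial off `S`, on `SU(N)`, every `N`, standing range):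
`∫ ρ·g(Ū^S U)·f₂(Ū^S U) dU = (∫ ρ·g(Ū^S U) dU)·(∫ f₂ dV)` for `ρ` integrable and local off the far-selected bonds (selected outside the end blocks of `S`), `g` local off `Far`,
`f₂` local on `Far`. [cite: Balaban1985UV3, (2) p.256 + (10) p.258; Balaban1985Averaging, (15) p.19; Balaban1987RG1, (0.4) p.253 (bookkeeping)] -/
theorem integral_mul_hybrid_far_eq_avOfPrint (S₀ : Scales L) {j : ℕ} (hj : j + 1 ≤ S₀.P.m + S₀.P.K) [DecidableEq (PBond S₀.P (j + 1))]
    (S : Finset (PBond S₀.P (j + 1))) (Far : PBond S₀.P (j + 1) → Prop) [DecidablePred Far] (τ : PBond S₀.P (j + 1) → ℕ) (hτ : ∀ c, Far c → τ c < S₀.P.L)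
    (hτS : ∀ c', Far c' → ∀ c ∈ S, blockOf (lineSite c' (τ c')) ≠ c.src ∧ blockOf (lineSite c' (τ c')) ≠ c.tgt)
    [DecidablePred fun b : PBond S₀.P j => ∃ c, Far c ∧ line c (τ c) = b]
    (ρ : Density S₀.P j (SU N)) (hρ : Integrable ρ (fieldMeasure S₀.P j (SU N)))
    (hloc : ∀ W W' : GaugeField S₀.P j (SU N), (∀ b, (¬ ∃ c, Far c ∧ line c (τ c) = b) → W b = W' b) → ρ W = ρ W')
    (g f₂ : GaugeField S₀.P (j + 1) (SU N) → ℝ) (hg : Measurable g) (hf₂ : Measurable f₂) (Cg C₂ : ℝ) (hCg : ∀ V, |g V| ≤ Cg) (hC₂ : ∀ V, |f₂ V| ≤ C₂)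
    (hlocg : ∀ V V' : GaugeField S₀.P (j + 1) (SU N), (∀ c, ¬ Far c → V c = V' c) → g V = g V')
    (hloc₂ : ∀ V V' : GaugeField S₀.P (j + 1) (SU N), (∀ c, Far c → V c = V' c) → f₂ V = f₂ V') :
    ∫ U, ρ U * (g (fun c => if c ∈ S then avgFun (expMeanLogSU : LoopAverage (SU N)) U c else axialAvg U c) *
        f₂ (fun c => if c ∈ S then avgFun (expMeanLogSU : LoopAverage (SU N)) U c else axialAvg U c)) ∂(fieldMeasure S₀.P j (SU N)) =
      (∫ U, ρ U * g (fun c => if c ∈ S then avgFun (expMeanLogSU : LoopAverage (SU N)) U c else axialAvg U c) ∂(fieldMeasure S₀.P j (SU N))) *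
        ∫ V, f₂ V ∂(fieldMeasure S₀.P (j + 1) (SU N)) :=
  integral_mul_hybrid_far_eq (expMeanLogSU : LoopAverage (SU N)) hj measurable_expMeanLogSU_E S Far τ hτ hτS ρ hρ hloc g f₂ hg hf₂ Cg C₂ hCg hC₂ hlocg hloc₂

/-- ★★ **AT THE SLOT: THE FAR-AVERAGE IDENTITY** `∫ ρ·f(Ū^S U) dU = ∫ ρ·(A_Far f)(Ū^S U) dU` for the hybrid of print's averaging on `SU(N)`, every `N`, every bounded measurable `f`,
`ρ` integrable and local off the far-selected bonds — the transported density is a function of the near coarse variables only.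
[cite: Balaban1985UV3, (2) p.256 + (10) p.258; Balaban1985Averaging, (15) p.19; Balaban1987RG1, (0.4) p.253 (bookkeeping)] -/
theorem integral_mul_comp_hybrid_eq_farAvg_avOfPrint (S₀ : Scales L) {j : ℕ} (hj : j + 1 ≤ S₀.P.m + S₀.P.K) [DecidableEq (PBond S₀.P (j + 1))]
    (S : Finset (PBond S₀.P (j + 1))) (Far : PBond S₀.P (j + 1) → Prop) [DecidablePred Far] (τ : PBond S₀.P (j + 1) → ℕ) (hτ : ∀ c, Far c → τ c < S₀.P.L)
    (hτS : ∀ c', Far c' → ∀ c ∈ S, blockOf (lineSite c' (τ c')) ≠ c.src ∧ blockOf (lineSite c' (τ c')) ≠ c.tgt)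
    [DecidablePred fun b : PBond S₀.P j => ∃ c, Far c ∧ line c (τ c) = b]
    (ρ : Density S₀.P j (SU N)) (hρ : Integrable ρ (fieldMeasure S₀.P j (SU N)))
    (hloc : ∀ W W' : GaugeField S₀.P j (SU N), (∀ b, (¬ ∃ c, Far c ∧ line c (τ c) = b) → W b = W' b) → ρ W = ρ W')
    (f : GaugeField S₀.P (j + 1) (SU N) → ℝ) (hf : Measurable f) (C : ℝ) (hC : ∀ V, |f V| ≤ C) :
    ∫ U, ρ U * f (fun c => if c ∈ S then avgFun (expMeanLogSU : LoopAverage (SU N)) U c else axialAvg U c) ∂(fieldMeasure S₀.P j (SU N)) =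
      ∫ U, ρ U * (∫ v, f ((FibreSplit.splitEquiv Far (P := S₀.P) (G := SU N)).symm
          ((FibreSplit.splitEquiv Far (P := S₀.P) (G := SU N) (fun c => if c ∈ S then avgFun (expMeanLogSU : LoopAverage (SU N)) U c else axialAvg U c)).1, v))
        ∂(Measure.pi fun _ : {c : PBond S₀.P (j + 1) // ¬¬ Far c} => (HaarData.haar : Measure (SU N)))) ∂(fieldMeasure S₀.P j (SU N)) :=
  integral_mul_comp_hybrid_eq_farAvg (expMeanLogSU : LoopAverage (SU N)) hj measurable_expMeanLogSU_E S Far τ hτ hτS ρ hρ hloc f hf C hC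

end Slot

end Summit.QuantumFields.YangMills.BalabanUVNodes.N08HaarCompatibilityGuardHybridFresh

end
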